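import Summits.KontsevichZagierPeriods.KontsevichZagierPeriods.Theorems.RootDecompRationalCubeDichotomyNashMultiGenP16

/-!
# Route B — item 33041 `MultiGenDefectOne`: the registered line `slice1`, stub `stub_edge` BY NAME AND SIGNATURE

The registered skeleton «slice1» on stmt-KontsevichZagierPeriods-33041 (writer decomp-kz-writer-1 g6, skeleton sha 565ee6e0…, namespace
`…Cruxes.MultiGenDefectOne.Slice1`; critic decomp-kz-crit-1 g3 by-string stamps 13:43:10Z / 13:48:50Z) has two stubs: `stub_slice1 : Statement.stub_slice1`
(the residual «SliceNash 1», size M — OPEN) and `stub_edge : Statement.stub_slice1 → MultiGenDefectOne` (the kernel edge).  This module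
reproduces the skeleton-local `def Statement.stub_slice1` VERBATIM (a6/origin/S1_sig.txt) and proves `stub_edge` by the lens-2 g8 theorem
`item33041_of_sliceNash_one` (NashEtaleMultiGen v8 @968f0f93 §6.8, landed as `…Theorems.RootDecompRationalCubeDichotomyNashMultiGenP01–P16` by the
census seat) — `Statement.stub_slice1 ↔ SliceNash 1` and `Item33041 ↔ MultiGenDefectOne` are `Iff.rfl`.
-/

set_option linter.dupNamespace false

namespace Summit.KontsevichZagierPeriods.KontsevichZagierPeriods.Cruxes.MultiGenDefectOne.Slice1

/-- the STATEMENT of `stub_slice1` ("SliceNash 1"): δ-expansion of lens-2 g8 `SliceNash 1` (verbatim, skeleton «slice1», a6/origin/S1_sig.txt). -/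
def Statement.stub_slice1 : Prop := ∀ (m : ℕ) (s₀ : Fin m → ℝ), AlgebraicIndependent ℚ s₀ → ∀ (g : (Fin (m + 1) → ℝ) → ℝ) (U : Set (Fin (m + 1) → ℝ)), IsOpen U → (Fin.append s₀ (0 : Fin 1 → ℝ) : Fin (m + 1) → ℝ) ∈ U → Literature.NumberTheory.Transcendental.IsSemialgebraicFunOn ℚ U g → AnalyticOnNhd ℝ g U → ∃ (k : ℕ) (y₀ : Fin k → ℝ) (F : Fin k → MvPolynomial (Fin (m + 1 + k)) ℚ) (A B : MvPolynomial (Fin (m + 1 + k)) ℚ), (∀ i, MvPolynomial.aeval (Fin.append (Fin.append s₀ (0 : Fin 1 → ℝ)) y₀ : Fin (m + 1 + k) → ℝ) (F i) = 0) ∧ (Matrix.of fun i j : Fin k => MvPolynomial.aeval (Fin.append (Fin.append s₀ (0 : Fin 1 → ℝ)) y₀ : Fin (m + 1 + k) → ℝ) (MvPolynomial.pderiv (Fin.natAdd (m + 1) j) (F i))).det ≠ 0 ∧ MvPolynomial.aeval (Fin.append (Fin.append s₀ (0 : Fin 1 → ℝ)) y₀ : Fin (m + 1 + k) → ℝ)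 B ≠ 0 ∧ ∀ (V : Set (Fin 1 → ℝ)) (u : Fin k → (Fin 1 → ℝ) → ℝ), IsOpen V → (0 : Fin 1 → ℝ) ∈ V → (∀ j, u j 0 = y₀ j) → (∀ j, AnalyticOnNhd ℝ (u j) V) → (∀ t ∈ V, ∀ i, MvPolynomial.aeval (Fin.append (Fin.append s₀ t) (fun j => u j t) : Fin (m + 1 + k) → ℝ) (F i) = 0) → ∃ W ⊆ V, IsOpen W ∧ (0 : Fin 1 → ℝ) ∈ W ∧ ∀ t ∈ W, g (Fin.append s₀ t) = MvPolynomial.aeval (Fin.append (Fin.append s₀ t) (fun j => u j t) : Fin (m + 1 + k) → ℝ) A / MvPolynomial.aeval (Fin.append (Fin.append s₀ t) (fun j => u j t) : Fin (m + 1 + k) → ℝ) B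

/-- the skeleton def IS the lens's `SliceNash 1` -/
theorem statement_stub_slice1_iff : Statement.stub_slice1 ↔ Summit.KontsevichZagierPeriods.RootDecompRationalCubeDichotomy.Rung29430.MultiGen.SliceNash 1 := Iff.rfl

/-- the lens's mirror `Item33041` IS the born route decl `MultiGenDefectOne` -/
private theorem item33041_iff_born : Summit.KontsevichZagierPeriods.RootDecompRationalCubeDichotomy.Rung29430.MultiGen.Item33041 ↔ Summit.KontsevichZagierPeriods.KontsevichZagierPeriods.Theses.RootDecompRationalCubeDichotomy.MultiGenDefectOne := Iff.rfl

/-- **`stub_edge` of line «slice1» on item 33041, PROVED** (the kernel edge SliceNash 1 ⟹ MultiGenDefectOne, every dimension n) — by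
`MultiGen.item33041_of_sliceNash_one` (lens-2 g8 §6.8: spreading out over ℚ[s₀] + the generic identity principle + codimension-one charts). -/
theorem stub_edge :
    Statement.stub_slice1 → Summit.KontsevichZagierPeriods.KontsevichZagierPeriods.Theses.RootDecompRationalCubeDichotomy.MultiGenDefectOne :=
  fun h => item33041_iff_born.mp (Summit.KontsevichZagierPeriods.RootDecompRationalCubeDichotomy.Rung29430.MultiGen.item33041_of_sliceNash_one (statement_stub_slice1_iff.mp h))

end Summit.KontsevichZagierPeriods.KontsevichZagierPeriods.Cruxes.MultiGenDefectOne.Slice1
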